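import Summits.RiemannHypothesis.RiemannHypothesis.Theorems.TiltedLandingLaw421R3RateClusterCount

/-! # TiltedLandingLaw421R3PairCount — W1≤ (the window count INEQUALITY), pair clearance, the weight-two count — W-08 C1 (rh-idea-5 g35), file 1 of 2

SUPPORT module for crux `TiltedLandingLaw421R` ⟨stmt-RiemannHypothesis-33346⟩, route EarlyAppointments (`--supports … --as helper` only; no stub, no crux,
no placeholder).  File 1 of the PAIR-WINDOW pair whose file 2 (`…R3PairWindow`) proves lens-2's RUNG-P door `RhW08.PerturbativeRung.ChildEnergyTwoLeQ`
(RungP-v4/v5, HELD until GO-33-28) unfolded.  Contents, all (K):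
§1 ★★ W1≤ for a real entire `G` of order `< 2` in a Jensen `Window` (with a zero somewhere): the zeros of `G′` OFF `Z(G)` in the upper half of the open
window, counted with multiplicity, are AT MOST the DISTINCT upper zeros of `G` there — `upper_offZero_count_deriv_le_ncard`; from Kim 1996 Thm 1
`J′ ≤ J` (tree `Splittings.JensenWindow.nonreal_zeros_deriv_le`, Ki–Kim `fourK ≥ 0`) with the order bookkeeping of #1174 `…R3RateClusterCount`
(`finsum_untop₀_eq_cast`, `zeroCountC_eq_real_add_nonreal`, `finsum_nonreal_eq_two_mul_upper`, `ncard_nonreal_eq_two_mul_upper`,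
`RhW08.RealCrit.analyticOrderNatAt_deriv_add_one_of_entire`).  NO local B (no Laguerre sign law on the base), hence NO range clause and NO `Charged` —
the `=` twins are #1174 `offZero_count_deriv_eq_ncard` / `upper_offZero_count_deriv_eq_ncard`, which need local B.
§2 ★★ the FRAME FORM `clusterCount_le`: legal frame (`EngineHyps5 2`), band state `v` of level `j` (`StTrkDQ`), abscissae `α < Re v < β` crossed by no
open Jensen shadow of `f⁽ʲ⁾`, clean feet ⇒ the upper zeros of `f⁽ʲ⁺¹⁾` off `Z(f⁽ʲ⁾)` with abscissa in `(α, β)` are finitely many and, weighted by order,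
`≤ ncard {upper zeros of f⁽ʲ⁾ with abscissa in (α, β)}` (tree `RhW08.Column.window_of_clear`, `RhW08.ClusterCount.window_sets_eq`; the `=` version
#1174 `clusterCount` needs local B, `clusterCount_of_charged` needs the window in the LAW's range).
§3 PAIR CLEARANCE for a conj-symmetric zero predicate `Z` and a touching atomic pair `v, z` (`Im v < Im z`, `|Re v − Re z| ≤ Im v + Im z`, every other
upper `Z`-point disc-separated from both): admissible endpoints (`α ≤ min(Re v − Im v, Re z − Im z)` dominating `Re u + Im u` of the other upper points
left of `v`; mirror for `β`) are shadow-clear; the other upper points lie laterally outside `[min, max]`; none has abscissa in `(α, β)`; the window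
identity `{upper Z-points with abscissa in (α, β)} = {v, z}`.
§4 the WEIGHT-TWO COUNT: positive integer weights summing to `2` on a finset containing `u₁ ≠ u₂` ⇒ the finset is `{u₁, u₂}` with unit weights; the
weighted `Im²`-sum over any sub-family is `≤ Im u₁² + Im u₂²`; `finsum` forms `energy_le_of_count` (`= 2`) and `energy_le_of_count_le` (`≤ 2` on a finite
family).
§3/§4 and the `finsum` plumbing are C1 g34's published kernel pieces (`PairClear` dea02c42, `PairCount` 28a314b5, skeleton 0d17c711) re-homed in this
namespace, proof bodies verbatim (one namespace qualifier dropped).  Nothing here bears on the truth of RH; RH is NOT proved; RUNG-P a candidate;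
★A / 33346 / 33347 OPEN; checked ≠ landed ≠ proved. -/

namespace RhW08.PairCount

open Complex ComplexConjugate Set Metric
open Literature.Analysis.Complex
open Summit.RiemannHypothesis.RiemannHypothesis.Theorems.Splittings.JensenWindow
open RhW08.ClusterCount
open RhIdea6.G17.W07C7 RhIdea6.G17.W07C7.Rev6 RhW08.QuadW

/-! ## §1 W1≤ — THE WINDOW COUNT INEQUALITY for a real entire `G` of order `< 2` (Kim 1996 Thm 1 `J′ ≤ J`; NO local B) -/

section CountLe

variable {G : ℂ → ℂ}

/-- ★ (K) §1 in a Jensen `Window` of `G` (with a zero somewhere), the NON-REAL zeros of `G′` in the open window, counted with multiplicity, are AT MOST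
those of `G` (tree `nonreal_zeros_deriv_le`: the difference is `fourK/2 ≥ 0`; no Laguerre sign law on the base is assumed). -/
theorem nonreal_count_deriv_le (hG : RealEntireLt2 G) {α β h : ℝ} (hW : Window G α β h) (hex : ∃ a, G a = 0) :
    ∑ᶠ ρ ∈ {ρ : ℂ | (deriv G ρ = 0 ∧ ρ ∈ (Ioo α β ×ℂ Ioo (-h) h)) ∧ ρ.im ≠ 0}, analyticOrderNatAt (deriv G) ρ ≤
      ∑ᶠ ρ ∈ {ρ : ℂ | (G ρ = 0 ∧ ρ ∈ (Ioo α β ×ℂ Ioo (-h) h)) ∧ ρ.im ≠ 0}, analyticOrderNatAt G ρ := by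
  classical
  set K : Set ℂ := Ioo α β ×ℂ Ioo (-h) h with hKdef
  obtain ⟨hfin, hfin'⟩ := finite_window hG hW
  have hZ : {ρ : ℂ | (G ρ = 0 ∧ ρ ∈ K) ∧ ρ.im ≠ 0}.Finite := hfin.subset fun ρ hρ => hρ.1
  have hC : {ρ : ℂ | (deriv G ρ = 0 ∧ ρ ∈ K) ∧ ρ.im ≠ 0}.Finite := hfin'.subset fun ρ hρ => hρ.1
  obtain ⟨k, hk0, -, hk⟩ := nonreal_zeros_deriv_le hG hW hex
  rw [← hKdef, zeroCountC_eq_real_add_nonreal G K hfin, zeroCountC_eq_real_add_nonreal (deriv G) K hfin',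
    finsum_untop₀_eq_cast hG.diff hZ, finsum_untop₀_eq_cast hG.diff.deriv hC] at hk
  have hk' : ((2 * ((∑ ρ ∈ hZ.toFinset, analyticOrderNatAt G ρ : ℕ) : ℤ) -
      2 * ((∑ ρ ∈ hC.toFinset, analyticOrderNatAt (deriv G) ρ : ℕ) : ℤ) : ℤ) : ℂ) = ((k : ℤ) : ℂ) := by
    push_cast at hk ⊢
    linear_combination hk
  have hkz := Int.cast_injective hk'
  rw [finsum_mem_eq_finite_toFinset_sum _ hC, finsum_mem_eq_finite_toFinset_sum _ hZ]
  omega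

/-- ★★ (K) §1 **ZEROS OF `G′` OFF `Z(G)`, COUNTED WITH MULTIPLICITY ≤ NUMBER OF DISTINCT NON-REAL ZEROS OF `G`** (open window, both half-planes):
at a common zero `ord G′ = ord G − 1`, so `nonreal_count_deriv_le` sheds one unit per DISTINCT zero (the `≤` twin of #1174
`offZero_count_deriv_eq_ncard`, same bookkeeping). -/
theorem offZero_count_deriv_le_ncard (hG : RealEntireLt2 G) {α β h : ℝ} (hW : Window G α β h) (hex : ∃ a, G a = 0) :
    ∑ᶠ ρ ∈ {ρ : ℂ | (deriv G ρ = 0 ∧ G ρ ≠ 0 ∧ ρ ∈ (Ioo α β ×ℂ Ioo (-h) h)) ∧ ρ.im ≠ 0}, analyticOrderNatAt (deriv G) ρ ≤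
      {ρ : ℂ | (G ρ = 0 ∧ ρ ∈ (Ioo α β ×ℂ Ioo (-h) h)) ∧ ρ.im ≠ 0}.ncard := by
  classical
  set K : Set ℂ := Ioo α β ×ℂ Ioo (-h) h with hKdef
  have hd : Differentiable ℂ (deriv G) := hG.diff.deriv
  have hGne : G ≠ 0 := fun h0 => hW.fα (by rw [h0]; rfl)
  obtain ⟨hfin, hfin'⟩ := finite_window hG hW
  have hZ : {ρ : ℂ | (G ρ = 0 ∧ ρ ∈ K) ∧ ρ.im ≠ 0}.Finite := hfin.subset fun ρ hρ => hρ.1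
  have hC : {ρ : ℂ | (deriv G ρ = 0 ∧ ρ ∈ K) ∧ ρ.im ≠ 0}.Finite := hfin'.subset fun ρ hρ => hρ.1
  have hO : {ρ : ℂ | (deriv G ρ = 0 ∧ G ρ ≠ 0 ∧ ρ ∈ K) ∧ ρ.im ≠ 0}.Finite := hfin'.subset fun ρ hρ => ⟨hρ.1.1, hρ.1.2.2⟩
  have h1 := nonreal_count_deriv_le hG hW hex
  rw [← hKdef, finsum_mem_eq_finite_toFinset_sum _ hC, finsum_mem_eq_finite_toFinset_sum _ hZ] at h1
  have sumZ : ∑ ρ ∈ hZ.toFinset, analyticOrderNatAt G ρ = ∑ ρ ∈ hZ.toFinset, analyticOrderNatAt (deriv G) ρ + hZ.toFinset.card := by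
    rw [Finset.card_eq_sum_ones, ← Finset.sum_add_distrib]
    refine Finset.sum_congr rfl fun ρ hρ => ?_
    rw [Set.Finite.mem_toFinset] at hρ
    exact (RhW08.RealCrit.analyticOrderNatAt_deriv_add_one_of_entire hG.diff hGne hρ.1.1).symm
  have splitC := Finset.sum_filter_add_sum_filter_not hC.toFinset (fun ρ => G ρ ≠ 0) (fun ρ => analyticOrderNatAt (deriv G) ρ)
  have eO : hC.toFinset.filter (fun ρ => G ρ ≠ 0) = hO.toFinset := by
    ext ρ
    simp only [Finset.mem_filter, Set.Finite.mem_toFinset, mem_setOf_eq]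
    tauto
  have eC : ∑ ρ ∈ hC.toFinset.filter (fun ρ => ¬ G ρ ≠ 0), analyticOrderNatAt (deriv G) ρ =
      ∑ ρ ∈ hZ.toFinset, analyticOrderNatAt (deriv G) ρ := by
    apply Finset.sum_subset
    · intro ρ hρ
      simp only [Finset.mem_filter, Set.Finite.mem_toFinset, mem_setOf_eq, not_not] at hρ ⊢
      exact ⟨⟨hρ.2, hρ.1.1.2⟩, hρ.1.2⟩
    · intro ρ hρZ hρC
      rw [Set.Finite.mem_toFinset] at hρZ
      by_contra hne
      apply hρC
      rw [Finset.mem_filter, Set.Finite.mem_toFinset]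
      exact ⟨⟨⟨apply_eq_zero_of_analyticOrderNatAt_ne_zero hne, hρZ.1.2⟩, hρZ.2⟩, not_not.mpr hρZ.1.1⟩
  rw [eO, eC] at splitC
  rw [finsum_mem_eq_finite_toFinset_sum _ hO, Set.ncard_eq_toFinset_card _ hZ]
  omega

/-- ★★ (K) §1 **THE UPPER-HALF COUNT INEQUALITY**: the zeros of `G′` off `Z(G)` in the UPPER half of the open window, counted with multiplicity,
are at most the DISTINCT upper zeros of `G` there (conjugation halves both sides: #1174 `finsum_nonreal_eq_two_mul_upper`, `ncard_nonreal_eq_two_mul_upper`). -/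
theorem upper_offZero_count_deriv_le_ncard (hG : RealEntireLt2 G) {α β h : ℝ} (hW : Window G α β h) (hex : ∃ a, G a = 0) :
    ∑ᶠ ρ ∈ {ρ : ℂ | (deriv G ρ = 0 ∧ G ρ ≠ 0 ∧ ρ ∈ (Ioo α β ×ℂ Ioo (-h) h)) ∧ 0 < ρ.im}, analyticOrderNatAt (deriv G) ρ ≤
      {ρ : ℂ | (G ρ = 0 ∧ ρ ∈ (Ioo α β ×ℂ Ioo (-h) h)) ∧ 0 < ρ.im}.ncard := by
  have h2 := offZero_count_deriv_le_ncard hG hW hex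
  obtain ⟨hfin, hfin'⟩ := finite_window hG hW
  have hd : Differentiable ℂ (deriv G) := hG.diff.deriv
  have hdreal : ∀ x : ℝ, (deriv G x).im = 0 := im_deriv_ofReal hG.diff hG.real
  have hK : ∀ ρ : ℂ, conj ρ ∈ (Ioo α β ×ℂ Ioo (-h) h) ↔ ρ ∈ (Ioo α β ×ℂ Ioo (-h) h) := by
    intro ρ
    simp only [mem_reProdIm, conj_re, conj_im, mem_Ioo]
    constructor <;> rintro ⟨h1, h2, h3⟩ <;> exact ⟨h1, by linarith, by linarith⟩
  have hGc : ∀ ρ : ℂ, G (conj ρ) = 0 ↔ G ρ = 0 := fun ρ => by rw [apply_conj_eq_conj hG.diff hG.real, map_eq_zero]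
  have hdc : ∀ ρ : ℂ, deriv G (conj ρ) = 0 ↔ deriv G ρ = 0 := fun ρ => by rw [apply_conj_eq_conj hd hdreal, map_eq_zero]
  have hsO := finsum_nonreal_eq_two_mul_upper (fun ρ => deriv G ρ = 0 ∧ G ρ ≠ 0 ∧ ρ ∈ (Ioo α β ×ℂ Ioo (-h) h))
    (analyticOrderNatAt (deriv G)) (fun ρ => by rw [hdc, hK, ne_eq, ne_eq, hGc])
    (DeBruijn1950.analyticOrderNatAt_conj hd (apply_conj_eq_conj hd hdreal)) (hfin'.subset fun ρ hρ => ⟨hρ.1.1, hρ.1.2.2⟩)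
  have hsZ := ncard_nonreal_eq_two_mul_upper (fun ρ => G ρ = 0 ∧ ρ ∈ (Ioo α β ×ℂ Ioo (-h) h)) (fun ρ => by rw [hGc, hK])
    (hfin.subset fun ρ hρ => hρ.1)
  omega

end CountLe

/-! ## §2 THE FRAME FORM: a clear window of `f⁽ʲ⁾` with clean feet on a legal frame (NO local B, NO range, NO `Charged`) -/

/-- ★★ (K) §2 **W1≤ — THE CLUSTER COUNT INEQUALITY, window form.**  Legal frame, band state `v` of level `j`, abscissae `α < Re v < β` crossed by no
open Jensen shadow of `f⁽ʲ⁾`, clean feet (`f⁽ʲ⁾, f⁽ʲ⁺¹⁾ ≠ 0` at `α, β`).  THEN the upper zeros of `f⁽ʲ⁺¹⁾` OFF `Z(f⁽ʲ⁾)` with abscissa in `(α, β)` are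
finitely many and, counted with multiplicity, AT MOST the distinct upper zeros of `f⁽ʲ⁾` with abscissa in `(α, β)` (tree `window_of_clear`,
`window_sets_eq`, §1).  The `=` version is #1174 `clusterCount`, which needs local B on the base. -/
theorem clusterCount_le {η : ℝ} {f : ℂ → ℂ} {x₀ s hmax R Hs : ℝ} {B j : ℕ} {v : ℂ}
    (hE : EngineHyps5 2 η f x₀ s hmax R Hs B) (hv : StTrkDQ η f x₀ s hmax R Hs B j v) {α β : ℝ} (hαv : α < v.re) (hvβ : v.re < β)
    (hclα : ∀ a : ℂ, iteratedDeriv j f a = 0 → a.im ≠ 0 → |a.im| ≤ |α - a.re|)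
    (hclβ : ∀ a : ℂ, iteratedDeriv j f a = 0 → a.im ≠ 0 → |a.im| ≤ |β - a.re|)
    (hGα : iteratedDeriv j f α ≠ 0) (hGβ : iteratedDeriv j f β ≠ 0)
    (hdα : iteratedDeriv (j + 1) f α ≠ 0) (hdβ : iteratedDeriv (j + 1) f β ≠ 0) :
    {w : ℂ | (iteratedDeriv (j + 1) f w = 0 ∧ iteratedDeriv j f w ≠ 0 ∧ w.re ∈ Ioo α β) ∧ 0 < w.im}.Finite ∧
      ∑ᶠ w ∈ {w : ℂ | (iteratedDeriv (j + 1) f w = 0 ∧ iteratedDeriv j f w ≠ 0 ∧ w.re ∈ Ioo α β) ∧ 0 < w.im},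
          analyticOrderNatAt (iteratedDeriv (j + 1) f) w ≤
        {a : ℂ | (iteratedDeriv j f a = 0 ∧ a.re ∈ Ioo α β) ∧ 0 < a.im}.ncard := by
  obtain ⟨hW, -⟩ := RhW08.Column.window_of_clear hE hv hαv hvβ hclα hclβ hGα hGβ hdα hdβ
  have hG : RealEntireLt2 (iteratedDeriv j f) := RhW08.WindowLoss.realEntireLt2_iteratedDeriv (RhW08.Column.realEntireLt2_of_hyps hE) j
  have e1 : deriv (iteratedDeriv j f) = iteratedDeriv (j + 1) f := by rw [← iteratedDeriv_succ]
  have key := upper_offZero_count_deriv_le_ncard hG hW ⟨v, hv.2.1⟩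
  have hfin := (finite_window hG hW).2
  obtain ⟨eS, eZ⟩ := window_sets_eq hE hv.1 (iteratedDeriv_succ_ne_zero_of_zero hE.1 j hv.1 hv.2.1) α β
  rw [e1] at key hfin
  rw [eS, eZ] at key
  refine ⟨?_, key⟩
  rw [← eS]
  exact hfin.subset fun w hw => ⟨hw.1.1, hw.1.2.2⟩

/-! ## §3 PAIR CLEARANCE (generic zero predicate `Z`, conj-symmetric; a touching atomic pair `v, z`) — C1 g34 `PairClear` dea02c42, bodies verbatim -/

section Clear

variable {Z : ℂ → Prop} {v z : ℂ}

/-- from upper points to all non-real points by conjugation symmetry. -/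
theorem all_of_upper (hsymm : ∀ a, Z a → Z (conj a)) {γ : ℝ} (upper : ∀ b, Z b → 0 < b.im → b.im ≤ |γ - b.re|) :
    ∀ a, Z a → a.im ≠ 0 → |a.im| ≤ |γ - a.re| := by
  intro a hZa hima
  rcases lt_or_gt_of_ne hima with hneg | hpos
  · have hb := upper (conj a) (hsymm a hZa) (by rw [Complex.conj_im]; linarith)
    rw [Complex.conj_im, Complex.conj_re] at hb
    rw [abs_of_neg hneg]; exact hb
  · rw [abs_of_pos hpos]; exact upper a hZa hpos

/-- (P1) LEFT CLEARANCE from an admissible left endpoint. -/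
theorem hcl_left_of_admissible (hsymm : ∀ a, Z a → Z (conj a)) (hv : 0 < v.im) (hvz : v.im < z.im)
    (hat : ∀ u, Z u → 0 < u.im → u ≠ v → u ≠ z → v.im + u.im < |v.re - u.re| ∧ z.im + u.im < |z.re - u.re|)
    {α : ℝ} (hαv : α ≤ v.re - v.im) (hαz : α ≤ z.re - z.im)
    (hleft : ∀ u, Z u → 0 < u.im → u ≠ v → u ≠ z → u.re < v.re → u.re + u.im ≤ α) :
    ∀ a, Z a → a.im ≠ 0 → |a.im| ≤ |α - a.re| := by
  refine all_of_upper hsymm ?_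
  intro b hZb hb
  by_cases hbv : b = v
  · subst hbv
    calc b.im ≤ b.re - α := by linarith
      _ ≤ |α - b.re| := by rw [abs_sub_comm]; exact le_abs_self _
  by_cases hbz : b = z
  · subst hbz
    calc b.im ≤ b.re - α := by linarith
      _ ≤ |α - b.re| := by rw [abs_sub_comm]; exact le_abs_self _
  obtain ⟨h1, -⟩ := hat b hZb hb hbv hbz
  rcases lt_or_ge b.re v.re with hlt | hge
  · have := hleft b hZb hb hbv hbz hlt
    calc b.im ≤ α - b.re := by linarith
      _ ≤ |α - b.re| := le_abs_self _
  · rw [abs_of_nonpos (by linarith : v.re - b.re ≤ 0)] at h1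
    calc b.im ≤ b.re - α := by linarith
      _ ≤ |α - b.re| := by rw [abs_sub_comm]; exact le_abs_self _

/-- (P2) RIGHT CLEARANCE from an admissible right endpoint. -/
theorem hcl_right_of_admissible (hsymm : ∀ a, Z a → Z (conj a)) (hv : 0 < v.im) (hvz : v.im < z.im)
    (hat : ∀ u, Z u → 0 < u.im → u ≠ v → u ≠ z → v.im + u.im < |v.re - u.re| ∧ z.im + u.im < |z.re - u.re|)
    {β : ℝ} (hvβ : v.re + v.im ≤ β) (hzβ : z.re + z.im ≤ β)
    (hright : ∀ u, Z u → 0 < u.im → u ≠ v → u ≠ z → v.re < u.re → β ≤ u.re - u.im) :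
    ∀ a, Z a → a.im ≠ 0 → |a.im| ≤ |β - a.re| := by
  refine all_of_upper hsymm ?_
  intro b hZb hb
  by_cases hbv : b = v
  · subst hbv
    calc b.im ≤ β - b.re := by linarith
      _ ≤ |β - b.re| := le_abs_self _
  by_cases hbz : b = z
  · subst hbz
    calc b.im ≤ β - b.re := by linarith
      _ ≤ |β - b.re| := le_abs_self _
  obtain ⟨h1, -⟩ := hat b hZb hb hbv hbz
  rcases lt_or_ge v.re b.re with hlt | hge
  · have := hright b hZb hb hbv hbz hlt
    calc b.im ≤ b.re - β := by linarith
      _ ≤ |β - b.re| := by rw [abs_sub_comm]; exact le_abs_self _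
  · rw [abs_of_nonneg (by linarith : 0 ≤ v.re - b.re)] at h1
    calc b.im ≤ β - b.re := by linarith
      _ ≤ |β - b.re| := le_abs_self _

/-- (P3, left) every OTHER upper zero left of `v` is strictly left of BOTH Jensen intervals with room `Im u`: `Re u + Im u < min (Re v − Im v) (Re z − Im z)`
(atomic w.r.t. `v` puts it left of `v`ʼs interval; «right of `z`ʼs interval» would contradict `Touches`). -/
theorem left_other_lt_min (htouch : |v.re - z.re| ≤ v.im + z.im)
    (hat : ∀ u, Z u → 0 < u.im → u ≠ v → u ≠ z → v.im + u.im < |v.re - u.re| ∧ z.im + u.im < |z.re - u.re|)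
    {u : ℂ} (hZu : Z u) (hu : 0 < u.im) (huv : u ≠ v) (huz : u ≠ z) (hlt : u.re < v.re) :
    u.re + u.im < min (v.re - v.im) (z.re - z.im) := by
  obtain ⟨h1, h2⟩ := hat u hZu hu huv huz
  rw [abs_of_pos (by linarith : 0 < v.re - u.re)] at h1
  have ht := abs_le.mp htouch
  have h2' : u.re + u.im < z.re - z.im := by
    rcases le_or_gt u.re z.re with hle | hgt
    · rw [abs_of_nonneg (by linarith : 0 ≤ z.re - u.re)] at h2; linarith
    · rw [abs_of_neg (by linarith : z.re - u.re < 0)] at h2; linarith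
  exact lt_min (by linarith) h2'

/-- (P3, right) mirror: `max (Re v + Im v) (Re z + Im z) < Re u − Im u` for every other upper zero right of `v`. -/
theorem right_other_gt_max (htouch : |v.re - z.re| ≤ v.im + z.im)
    (hat : ∀ u, Z u → 0 < u.im → u ≠ v → u ≠ z → v.im + u.im < |v.re - u.re| ∧ z.im + u.im < |z.re - u.re|)
    {u : ℂ} (hZu : Z u) (hu : 0 < u.im) (huv : u ≠ v) (huz : u ≠ z) (hgt : v.re < u.re) :
    max (v.re + v.im) (z.re + z.im) < u.re - u.im := by
  obtain ⟨h1, h2⟩ := hat u hZu hu huv huz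
  rw [abs_of_neg (by linarith : v.re - u.re < 0)] at h1
  have ht := abs_le.mp htouch
  have h2' : z.re + z.im < u.re - u.im := by
    rcases le_or_gt z.re u.re with hle | hlt
    · rw [abs_of_nonpos (by linarith : z.re - u.re ≤ 0)] at h2; linarith
    · rw [abs_of_pos (by linarith : 0 < z.re - u.re)] at h2; linarith
  exact max_lt (by linarith) h2'

/-- no other upper zero has the abscissa of `v` (atomic w.r.t. `v`). -/
theorem re_ne_of_other (hv : 0 < v.im)
    (hat : ∀ u, Z u → 0 < u.im → u ≠ v → u ≠ z → v.im + u.im < |v.re - u.re| ∧ z.im + u.im < |z.re - u.re|)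
    {u : ℂ} (hZu : Z u) (hu : 0 < u.im) (huv : u ≠ v) (huz : u ≠ z) : u.re ≠ v.re := by
  intro h
  obtain ⟨h1, -⟩ := hat u hZu hu huv huz
  rw [h, sub_self, abs_zero] at h1
  linarith

/-- (P4) STEP 1ʼs `⊆`: with admissible endpoints (`hleft`/`hright` as in (P1)/(P2)), an upper zero with abscissa in `(α, β)` is `v` or `z`. -/
theorem no_other_in_window (hv : 0 < v.im)
    (hat : ∀ u, Z u → 0 < u.im → u ≠ v → u ≠ z → v.im + u.im < |v.re - u.re| ∧ z.im + u.im < |z.re - u.re|)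
    {α β : ℝ}
    (hleft : ∀ u, Z u → 0 < u.im → u ≠ v → u ≠ z → u.re < v.re → u.re + u.im ≤ α)
    (hright : ∀ u, Z u → 0 < u.im → u ≠ v → u ≠ z → v.re < u.re → β ≤ u.re - u.im)
    {u : ℂ} (hZu : Z u) (hu : 0 < u.im) (hα : α < u.re) (hβ : u.re < β) : u = v ∨ u = z := by
  by_contra h
  push Not at h
  rcases lt_trichotomy u.re v.re with hlt | heq | hgt
  · have := hleft u hZu hu h.1 h.2 hlt; linarith
  · exact re_ne_of_other hv hat hZu hu h.1 h.2 heq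
  · have := hright u hZu hu h.1 h.2 hgt; linarith

/-- (P4′) STEP 1 as a SET IDENTITY: the upper `Z`-points with abscissa in `(α, β)` are exactly `{v, z}`. -/
theorem window_upper_eq_pair (hZv : Z v) (hZz : Z z) (hv : 0 < v.im) (hvz : v.im < z.im)
    (hat : ∀ u, Z u → 0 < u.im → u ≠ v → u ≠ z → v.im + u.im < |v.re - u.re| ∧ z.im + u.im < |z.re - u.re|)
    {α β : ℝ} (hαv : α < v.re) (hvβ : v.re < β) (hαz : α < z.re) (hzβ : z.re < β)
    (hleft : ∀ u, Z u → 0 < u.im → u ≠ v → u ≠ z → u.re < v.re → u.re + u.im ≤ α)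
    (hright : ∀ u, Z u → 0 < u.im → u ≠ v → u ≠ z → v.re < u.re → β ≤ u.re - u.im) :
    {a : ℂ | (Z a ∧ a.re ∈ Set.Ioo α β) ∧ 0 < a.im} = {v, z} := by
  ext a
  simp only [Set.mem_setOf_eq, Set.mem_Ioo, Set.mem_insert_iff, Set.mem_singleton_iff]
  constructor
  · rintro ⟨⟨hZa, hα, hβ⟩, ha⟩
    exact no_other_in_window hv hat hleft hright hZa ha hα hβ
  · rintro (rfl | rfl)
    · exact ⟨⟨hZv, hαv, hvβ⟩, hv⟩
    · exact ⟨⟨hZz, hαz, hzβ⟩, by linarith⟩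

end Clear

/-! ## §4 THE WEIGHT-TWO COUNT — C1 g34 `PairCount` 28a314b5 bodies verbatim + the `finsum` plumbing of the g34 skeleton 0d17c711 (namespace qualifier dropped) -/

section Count

open Finset

/-- (C1) WEIGHT TWO ⇒ EXACTLY THE TWO GIVEN MEMBERS, EACH SIMPLE. -/
theorem eq_pair_of_sum_two {s : Finset ℂ} {w : ℂ → ℕ} (hw : ∀ x ∈ s, 1 ≤ w x) (hsum : ∑ x ∈ s, w x = 2)
    {u₁ u₂ : ℂ} (hne : u₁ ≠ u₂) (h₁ : u₁ ∈ s) (h₂ : u₂ ∈ s) :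
    s = {u₁, u₂} ∧ w u₁ = 1 ∧ w u₂ = 1 := by
  classical
  have hsub : ({u₁, u₂} : Finset ℂ) ⊆ s := by
    intro x hx
    rcases Finset.mem_insert.mp hx with rfl | hx
    · exact h₁
    · rw [Finset.mem_singleton] at hx; rw [hx]; exact h₂
  have hsplit := Finset.sum_sdiff hsub (f := w)
  -- `∑_{s \ {u₁,u₂}} w + (w u₁ + w u₂) = 2`
  rw [Finset.sum_pair hne, hsum] at hsplit
  have hw1 : 1 ≤ w u₁ := hw u₁ h₁
  have hw2 : 1 ≤ w u₂ := hw u₂ h₂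
  have hrest : ∑ x ∈ s \ {u₁, u₂}, w x = 0 := by omega
  have hw1' : w u₁ = 1 := by omega
  have hw2' : w u₂ = 1 := by omega
  refine ⟨?_, hw1', hw2'⟩
  -- the rest is empty: every member has weight ≥ 1
  have hempty : s \ {u₁, u₂} = ∅ := by
    by_contra hne'
    obtain ⟨x, hx⟩ := Finset.nonempty_iff_ne_empty.mpr hne'
    have hxs : x ∈ s := (Finset.mem_sdiff.mp hx).1
    have h1x : 1 ≤ w x := hw x hxs
    have hle : w x ≤ ∑ y ∈ s \ {u₁, u₂}, w y := Finset.single_le_sum (fun y _ => Nat.zero_le _) hx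
    omega
  have : s = (s \ {u₁, u₂}) ∪ {u₁, u₂} := (Finset.sdiff_union_of_subset hsub).symm
  rw [this, hempty, Finset.empty_union]

/-- (C2) THE ENERGY BOUND SHAPE: under (C1)ʼs hypotheses, for any `t ⊆ s` and any non-negative `g`, `∑ x ∈ t, (w x : ℝ) * g x ≤ g u₁ + g u₂`. -/
theorem weighted_sum_le_pair {s t : Finset ℂ} {w : ℂ → ℕ} (hw : ∀ x ∈ s, 1 ≤ w x) (hsum : ∑ x ∈ s, w x = 2)
    {u₁ u₂ : ℂ} (hne : u₁ ≠ u₂) (h₁ : u₁ ∈ s) (h₂ : u₂ ∈ s) (hts : t ⊆ s) {g : ℂ → ℝ} (hg : ∀ x, 0 ≤ g x) :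
    ∑ x ∈ t, (w x : ℝ) * g x ≤ g u₁ + g u₂ := by
  classical
  obtain ⟨hs, hw1, hw2⟩ := eq_pair_of_sum_two hw hsum hne h₁ h₂
  have hnn : ∀ x ∈ s, 0 ≤ (w x : ℝ) * g x := fun x _ => mul_nonneg (Nat.cast_nonneg _) (hg x)
  calc ∑ x ∈ t, (w x : ℝ) * g x ≤ ∑ x ∈ s, (w x : ℝ) * g x :=
        Finset.sum_le_sum_of_subset_of_nonneg hts (fun x hx _ => hnn x hx)
    _ = g u₁ + g u₂ := by rw [hs, Finset.sum_pair hne, hw1, hw2]; push_cast; ring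

end Count

/-- (K) §4 `finsum` plumbing: a weight-two window count majorises the energy of any sub-family by the two located members. -/
theorem energy_le_of_count {W T : Set ℂ} {ord : ℂ → ℕ} (hcount : ∑ᶠ w ∈ W, ord w = 2) (hpos : ∀ w ∈ W, 1 ≤ ord w)
    {u₁ u₂ : ℂ} (hne : u₁ ≠ u₂) (h₁ : u₁ ∈ W) (h₂ : u₂ ∈ W) (hsub : T ⊆ W) :
    ∑ᶠ u ∈ T, (ord u : ℝ) * u.im ^ 2 ≤ u₁.im ^ 2 + u₂.im ^ 2 := by
  classical
  have hfinW : W.Finite := by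
    by_contra hinf
    have hsupp : W ∩ Function.support ord = W := by
      ext w
      simp only [Set.mem_inter_iff, Function.mem_support, ne_eq, and_iff_left_iff_imp]
      intro hw
      have := hpos w hw
      omega
    have h0 : ∑ᶠ w ∈ W, ord w = 0 := finsum_mem_eq_zero_of_infinite (by rw [hsupp]; exact hinf)
    omega
  have hT : T.Finite := hfinW.subset hsub
  rw [finsum_mem_eq_finite_toFinset_sum _ hT]
  rw [finsum_mem_eq_finite_toFinset_sum _ hfinW] at hcount
  refine weighted_sum_le_pair (s := hfinW.toFinset) (t := hT.toFinset)
    (fun x hx => hpos x (hfinW.mem_toFinset.mp hx)) hcount hne (hfinW.mem_toFinset.mpr h₁) (hfinW.mem_toFinset.mpr h₂)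
    (Set.Finite.toFinset_subset_toFinset.mpr hsub) (fun x => sq_nonneg _)

/-- (K) §4 the `≤ 2` form: on a FINITE window family of weights `≥ 1` with total weight `≤ 2`, two distinct members force total weight `= 2`, so
`energy_le_of_count` applies. -/
theorem energy_le_of_count_le {W T : Set ℂ} {ord : ℂ → ℕ} (hfinW : W.Finite) (hcount : ∑ᶠ w ∈ W, ord w ≤ 2) (hpos : ∀ w ∈ W, 1 ≤ ord w)
    {u₁ u₂ : ℂ} (hne : u₁ ≠ u₂) (h₁ : u₁ ∈ W) (h₂ : u₂ ∈ W) (hsub : T ⊆ W) :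
    ∑ᶠ u ∈ T, (ord u : ℝ) * u.im ^ 2 ≤ u₁.im ^ 2 + u₂.im ^ 2 := by
  classical
  refine energy_le_of_count (le_antisymm hcount ?_) hpos hne h₁ h₂ hsub
  rw [finsum_mem_eq_finite_toFinset_sum _ hfinW]
  have hsub2 : ({u₁, u₂} : Finset ℂ) ⊆ hfinW.toFinset := by
    intro x hx
    rw [Set.Finite.mem_toFinset]
    rcases Finset.mem_insert.mp hx with rfl | hx
    · exact h₁
    · rw [Finset.mem_singleton] at hx; rw [hx]; exact h₂
  have hw1 := hpos u₁ h₁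
  have hw2 := hpos u₂ h₂
  calc 2 ≤ ord u₁ + ord u₂ := by omega
    _ = ∑ x ∈ ({u₁, u₂} : Finset ℂ), ord x := (Finset.sum_pair hne).symm
    _ ≤ ∑ x ∈ hfinW.toFinset, ord x := Finset.sum_le_sum_of_subset_of_nonneg hsub2 fun _ _ _ => Nat.zero_le _

end RhW08.PairCount
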